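import Summits.Parity.GeneralizedHardyLittlewood.Theorems.CosetDecorrelation.Negative.CosetDecorrelationDegenerations

/-!
# `CosetDecorrelation` (stmt-Parity-13317): the exact-coincidence diagonal of a coset sum is thin

Negative-side (tightness / no-go) lemma for the crux `LiouvilleMAD.CosetDecorrelation` (route LiouvilleMAD, rank 2),
line lead c5.  The crux bounds `T_j(n,n';c,M) = Σ_{(m,m') ∈ P_j(M)} λ(mn+c) λ(m'n'+c)` by `C·M^{3/4+ϑ}`, `ϑ < 1/4`,
where `P_j(M) = {(m,m') ∈ (M,2M]² : m ≡ m' (mod j)}` (`Negative.pairs M j`) and `j > √M`.  The one sign-definite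
sub-sum that exists for EVERY completely multiplicative `±1`-valued function is the exact-coincidence diagonal
`mn = m'n'` (there `λ(mn+c) λ(m'n'+c) = λ(mn+c)² ≥ 0`).  This file shows that diagonal is negligible: for distinct
positive dilations it has at most `M / j + 1 ≤ ⌊√M⌋ + 1` points (`coincidence_coset_card_le`,
`coincidence_coset_card_le_sqrt`), hence contributes at most `⌊√M⌋ + 1 = o(M^{3/4})` to `T_j`
(`abs_coincidenceDiagonal_le`).  So no Ω-result for the crux (and no bias in its favour) can come from exact
coincidences; compare the aligned-shift degeneration `Negative.aligned_shift` (which needs `j ≤ |c|`).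

Proof: with `g = gcd(n,n')`, `n = ag`, `n' = bg`, `gcd(a,b) = 1`, `a ≠ b`, the coincidences are `(m,m') = (kb, ka)`;
the congruence `kb ≡ ka (mod j)` forces `j / gcd(j,|a−b|) ∣ k`, so the larger coordinate runs over multiples of
`max(a,b) · j / gcd(j,|a−b|) ≥ j` inside `(M,2M]` — at most `M / j + 1` of them.  [folklore]
-/

namespace Summit.Parity.GeneralizedHardyLittlewood.Theorems.CosetDecorrelation.Negative

open Finset

/-- Multiples of `L ≥ 1` in the dyadic block `(M, 2M]` number at most `M / L + 1`. -/
theorem card_Ioc_filter_dvd_le (M L : ℕ) (hL : 0 < L) :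
    ((Ioc M (2 * M)).filter (fun m => L ∣ m)).card ≤ M / L + 1 := by
  set A := (Ioc 0 (2 * M)).filter (fun m => L ∣ m) with hA
  set B := (Ioc 0 M).filter (fun m => L ∣ m) with hB
  have hAB : (Ioc M (2 * M)).filter (fun m => L ∣ m) = A \ B := by
    ext m
    simp only [hA, hB, mem_filter, mem_Ioc, mem_sdiff]
    constructor
    · rintro ⟨⟨h1, h2⟩, h3⟩
      exact ⟨⟨⟨by omega, h2⟩, h3⟩, fun h => by omega⟩
    · rintro ⟨⟨⟨h1, h2⟩, h3⟩, h4⟩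
      refine ⟨⟨?_, h2⟩, h3⟩
      by_contra h5
      exact h4 ⟨⟨h1, by omega⟩, h3⟩
  have hBA : B ⊆ A := by
    intro m
    simp only [hA, hB, mem_filter, mem_Ioc]
    rintro ⟨⟨h1, h2⟩, h3⟩
    exact ⟨⟨h1, by omega⟩, h3⟩
  have hcardA : A.card = 2 * M / L := Nat.Ioc_filter_dvd_card_eq_div (2 * M) L
  have hcardB : B.card = M / L := Nat.Ioc_filter_dvd_card_eq_div M L
  have hsd : (A \ B).card + (A ∩ B).card = A.card := card_sdiff_add_card_inter A B
  have hint : A ∩ B = B := inter_eq_right.mpr hBA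
  rw [hint, hcardA, hcardB] at hsd
  have h2 : 2 * M / L ≤ M / L + M / L + 1 := by
    rw [two_mul, Nat.add_div hL]
    split_ifs <;> omega
  rw [hAB]
  omega

/-- Ordered coprime case: for coprime `b < a`, the pairs `(m,m') ∈ P_j(M)` with `m·a = m'·b` number at most
`M / j + 1` (the second coordinate is a multiple of `a · (j / gcd(j, a−b)) ≥ j`). -/
theorem card_pairs_filter_mul_eq_le_of_lt (M j a b : ℕ) (hj : 0 < j) (hb : 0 < b) (hba : b < a)
    (hcop : Nat.Coprime a b) :
    ((pairs M j).filter (fun p : ℕ × ℕ => p.1 * a = p.2 * b)).card ≤ M / j + 1 := by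
  have ha : 0 < a := lt_trans hb hba
  set h := Nat.gcd j (a - b) with hh
  have hab0 : 0 < a - b := Nat.sub_pos_of_lt hba
  have hh0 : 0 < h := Nat.gcd_pos_of_pos_left _ hj
  have hhj : h ∣ j := Nat.gcd_dvd_left j (a - b)
  have hhab : h ∣ (a - b) := Nat.gcd_dvd_right j (a - b)
  have hle_ab : h ≤ a - b := Nat.le_of_dvd hab0 hhab
  have hle_a : h ≤ a := le_trans hle_ab (Nat.sub_le a b)
  set L := a * (j / h) with hL
  have hjh : j / h * h = j := Nat.div_mul_cancel hhj
  have hLj : j ≤ L := by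
    calc j = h * (j / h) := by rw [mul_comm, hjh]
      _ ≤ a * (j / h) := Nat.mul_le_mul_right _ hle_a
  have hL0 : 0 < L := lt_of_lt_of_le hj hLj
  have hcop2 : Nat.Coprime (j / h) ((a - b) / h) := Nat.coprime_div_gcd_div_gcd hh0
  calc ((pairs M j).filter (fun p : ℕ × ℕ => p.1 * a = p.2 * b)).card
      ≤ ((Ioc M (2 * M)).filter (fun m => L ∣ m)).card := by
        apply card_le_card_of_injOn (fun p : ℕ × ℕ => p.2)
        · intro p hp
          simp only [coe_filter, pairs, mem_filter, mem_product, mem_Ioc, Set.mem_setOf_eq] at hp ⊢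
          obtain ⟨⟨⟨_, hm'⟩, hmod⟩, heq⟩ := hp
          refine ⟨hm', ?_⟩
          have hadvd : a ∣ p.2 := by
            have : a ∣ p.2 * b := ⟨p.1, by rw [← heq]; ring⟩
            exact hcop.dvd_of_dvd_mul_right this
          obtain ⟨k, hk⟩ := hadvd
          have hp1 : p.1 = k * b := by
            have : p.1 * a = (k * b) * a := by rw [heq, hk]; ring
            exact Nat.eq_of_mul_eq_mul_right ha this
          have hkab : k * b ≤ k * a := Nat.mul_le_mul_left k (le_of_lt hba)
          have hmod' : k * b ≡ k * a [MOD j] := by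
            have : p.1 ≡ p.2 [MOD j] := hmod
            rw [hp1, hk, mul_comm a k] at this
            exact this
          have hjdvd : j ∣ k * a - k * b := (Nat.modEq_iff_dvd' hkab).1 hmod'
          have hjdvd' : j ∣ k * (a - b) := by rwa [Nat.mul_sub k a b]
          have H : (j / h) * h ∣ (k * ((a - b) / h)) * h := by
            rwa [hjh, mul_assoc, Nat.div_mul_cancel hhab]
          have H' : j / h ∣ k * ((a - b) / h) := Nat.dvd_of_mul_dvd_mul_right hh0 H
          have hq : j / h ∣ k := hcop2.dvd_of_dvd_mul_right H'
          rw [hk]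
          exact mul_dvd_mul_left a hq
        · intro p hp q hq hpq
          simp only [coe_filter, pairs, mem_filter, mem_product, Set.mem_setOf_eq] at hp hq
          have h1 : p.1 * a = p.2 * b := hp.2
          have h2 : q.1 * a = q.2 * b := hq.2
          have hpq' : p.2 = q.2 := hpq
          have : p.1 = q.1 := by
            apply Nat.eq_of_mul_eq_mul_right ha
            rw [h1, h2, hpq']
          exact Prod.ext this hpq'
    _ ≤ M / L + 1 := card_Ioc_filter_dvd_le M L hL0
    _ ≤ M / j + 1 := by
        have : M / L ≤ M / j := Nat.div_le_div_left hLj hj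
        omega

/-- Swapping the coordinates of the coset exchanges the roles of the two multipliers. -/
theorem card_pairs_filter_mul_eq_swap (M j a b : ℕ) :
    ((pairs M j).filter (fun p : ℕ × ℕ => p.1 * a = p.2 * b)).card
      = ((pairs M j).filter (fun p : ℕ × ℕ => p.1 * b = p.2 * a)).card := by
  apply Finset.card_bij (fun p _ => p.swap)
  · intro p hp
    simp only [pairs, mem_filter, mem_product, Prod.fst_swap, Prod.snd_swap] at hp ⊢
    exact ⟨⟨⟨hp.1.1.2, hp.1.1.1⟩, hp.1.2.symm⟩, hp.2.symm⟩
  · intro p _ q _ hpq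
    exact Prod.swap_injective hpq
  · intro q hq
    refine ⟨q.swap, ?_, Prod.swap_swap q⟩
    simp only [pairs, mem_filter, mem_product, Prod.fst_swap, Prod.snd_swap] at hq ⊢
    exact ⟨⟨⟨hq.1.1.2, hq.1.1.1⟩, hq.1.2.symm⟩, hq.2.symm⟩

/-- **The exact-coincidence diagonal is thin.**  For distinct positive dilations `n ≠ n'` and any modulus
`j ≥ 1`, the pairs `(m,m') ∈ P_j(M)` (both in `(M,2M]`, `m ≡ m' (mod j)`) with `mn = m'n'` number at most
`M / j + 1`. -/
theorem coincidence_coset_card_le (M j n n' : ℕ) (hj : 0 < j) (hn : 0 < n) (hn' : 0 < n')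
    (hne : n ≠ n') :
    ((pairs M j).filter (fun p : ℕ × ℕ => p.1 * n = p.2 * n')).card ≤ M / j + 1 := by
  set g := Nat.gcd n n' with hg
  have hg0 : 0 < g := Nat.gcd_pos_of_pos_left _ hn
  set a := n / g with ha_def
  set b := n' / g with hb_def
  have hna : a * g = n := Nat.div_mul_cancel (Nat.gcd_dvd_left n n')
  have hnb : b * g = n' := Nat.div_mul_cancel (Nat.gcd_dvd_right n n')
  have hcop : Nat.Coprime a b := Nat.coprime_div_gcd_div_gcd hg0
  have ha0 : 0 < a := Nat.div_pos (Nat.le_of_dvd hn (Nat.gcd_dvd_left n n')) hg0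
  have hb0 : 0 < b := Nat.div_pos (Nat.le_of_dvd hn' (Nat.gcd_dvd_right n n')) hg0
  have hab : a ≠ b := fun h => hne (by rw [← hna, ← hnb, h])
  have hfilter : (pairs M j).filter (fun p : ℕ × ℕ => p.1 * n = p.2 * n')
      = (pairs M j).filter (fun p : ℕ × ℕ => p.1 * a = p.2 * b) := by
    apply filter_congr
    intro p _
    constructor
    · intro h
      apply Nat.eq_of_mul_eq_mul_right hg0
      rw [mul_assoc, mul_assoc, hna, hnb]
      exact h
    · intro h
      rw [← hna, ← hnb, ← mul_assoc, ← mul_assoc, h]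
  rw [hfilter]
  rcases lt_or_gt_of_ne hab with hlt | hgt
  · rw [card_pairs_filter_mul_eq_swap]
    exact card_pairs_filter_mul_eq_le_of_lt M j b a hj ha0 hlt hcop.symm
  · exact card_pairs_filter_mul_eq_le_of_lt M j a b hj hb0 hgt hcop

/-- In the crux's window `j ≥ ⌊√M⌋ + 1` the coincidence diagonal has at most `⌊√M⌋ + 1` points. -/
theorem coincidence_coset_card_le_sqrt (M j n n' : ℕ) (hj : Nat.sqrt M + 1 ≤ j) (hn : 0 < n) (hn' : 0 < n')
    (hne : n ≠ n') :
    ((pairs M j).filter (fun p : ℕ × ℕ => p.1 * n = p.2 * n')).card ≤ Nat.sqrt M + 1 := by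
  have hj0 : 0 < j := lt_of_lt_of_le (Nat.succ_pos _) hj
  have h1 := coincidence_coset_card_le M j n n' hj0 hn hn' hne
  have h2 : M / j ≤ M / (Nat.sqrt M + 1) := Nat.div_le_div_left hj (Nat.succ_pos _)
  have h3 : M / (Nat.sqrt M + 1) ≤ Nat.sqrt M := by
    have hlt : M < (Nat.sqrt M + 1) * (Nat.sqrt M + 1) := Nat.lt_succ_sqrt M
    have : M / (Nat.sqrt M + 1) < Nat.sqrt M + 1 :=
      (Nat.div_lt_iff_lt_mul (Nat.succ_pos _)).2 hlt
    omega
  omega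

/-- On the coincidence diagonal the two Liouville factors coincide, so each term is `λ(mn+c)² ∈ {0,1}`; hence the
diagonal part of the crux's sum `T_j(n,n';c,M)` lies in `[0, ⌊√M⌋ + 1]` throughout the crux's window — it is
`o(M^{3/4})` and can neither threaten nor help the bound `C·M^{3/4+ϑ}`. -/
theorem abs_coincidenceDiagonal_le (c : ℤ) (M j n n' : ℕ) (hj : Nat.sqrt M + 1 ≤ j) (hn : 0 < n)
    (hn' : 0 < n') (hne : n ≠ n') :
    |∑ p ∈ (pairs M j).filter (fun p : ℕ × ℕ => p.1 * n = p.2 * n'), u n c p.1 * u n' c p.2|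
      ≤ (Nat.sqrt M : ℝ) + 1 := by
  have hcard := coincidence_coset_card_le_sqrt M j n n' hj hn hn' hne
  calc |∑ p ∈ (pairs M j).filter (fun p : ℕ × ℕ => p.1 * n = p.2 * n'), u n c p.1 * u n' c p.2|
      ≤ ∑ p ∈ (pairs M j).filter (fun p : ℕ × ℕ => p.1 * n = p.2 * n'), |u n c p.1 * u n' c p.2| :=
        abs_sum_le_sum_abs _ _
    _ ≤ ∑ _p ∈ (pairs M j).filter (fun p : ℕ × ℕ => p.1 * n = p.2 * n'), (1 : ℝ) := by
        apply sum_le_sum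
        intro p _
        rw [abs_mul]
        have h1 := abs_u_le_one n c p.1
        have h2 := abs_u_le_one n' c p.2
        calc |u n c p.1| * |u n' c p.2| ≤ 1 * 1 :=
              mul_le_mul h1 h2 (abs_nonneg _) zero_le_one
          _ = 1 := one_mul 1
    _ = (((pairs M j).filter (fun p : ℕ × ℕ => p.1 * n = p.2 * n')).card : ℝ) := by simp
    _ ≤ (Nat.sqrt M : ℝ) + 1 := by exact_mod_cast hcard

end Summit.Parity.GeneralizedHardyLittlewood.Theorems.CosetDecorrelation.Negative
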